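import Summits.CriticalPhenomena.SAWScalingLimit.Theorems.SAWDevelopingMapObservableToSLERestrictionCocycleHelpersFloor
import Summits.CriticalPhenomena.SAWScalingLimit.Theorems.SAWDefectDecoherenceBoundaryWindingRigidity
import HarnessLib

/-!
# Crux `SAWDefectDecoherence.ObservableToSLER` (stmt-CriticalPhenomena-14005), line
`bridge-gate-renewal` (reshape r7), stub 5a2 `stub_twoPieceAdmRestrictionLimit`: lattice helpers

Landing target:
`Summits/CriticalPhenomena/SAWScalingLimit/Theorems/SAWDefectDecoherenceObservableToSLERTwoPieceRestrictionLimitFloor.lean`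
(`--supports stmt-CriticalPhenomena-14005`).

Stub 5a2 is the TWO-PIECE port of crux 10472's landed restriction cocycle
(`FloorRatio.stub_restrictionCocycle`, `…SAWDevelopingMapObservableToSLERestrictionCocycle.lean`):
the Dobrushin domain is flat at each marked point separately (different heights, no global floor),
the two nested admissible families `Λ' δ ⊆ Λ δ` are exact upper half-lattices with a COMMON free
threshold `m₀ δ` in the ball at `pt 0` and separate thresholds at `pt 1`.  This file supplies the
three lattice facts of the port that differ from the floor case:

* `norm_observable_eq_archMass` — **winding rigidity in modulus form** replaces the global-floor
  winding lemma `norm_hexParafermionicObservable_floorEdge` (strip embedding): for a simply connected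
  `Λ` and boundary mid-edges `a, e` all walks `a → e` have the same winding (the route's landed
  support item `BoundaryWindingRigidity`, `boundaryWindingRigidity_proof`), so
  `‖F_{x_c,σ}(e)‖ = Z_Λ(a, e) = Σ_{γ ⊂ Λ : a → e} x_c^{ℓ(γ)}`;
* `archMass_le_archMass_add_farMass_mesh` — the near/far splitting of the exact restriction deficit
  `Z_Λ(s,t) ≤ Z_{Λ'}(s,t) + (far mass)` with CONTINUUM (mesh-scaled) distances, the form in which
  the anchor `TwoPieceSourceLocality` measures "far";
* `twoPieceFloorData` — the **local** lattice floor data at the first marked point `p`: from the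
  row clause in the ball `B(p, ρ)` alone (no global floor, nothing at the second marked point), for a
  floor point `s ≠ p` on the line `Im = Im p` with `|s - p| < ρ/4`, lattice floor points `s_δ → s`
  (vertical floor mid-edges of the row `m₀ δ`) which are eventually boundary mid-edges of both
  families at the height of `a δ`, joined to `a δ` by walks of both families, together with the
  inclusion in `Λ' δ` of the vertices of `Λ δ` at scaled distance `< r` from `δ·mid(a δ)` (`2r < ρ`).
-/

noncomputable section

open scoped BigOperators Topology Classical
open Filter Set Metric
open Literature.Probability.LatticeModels (HexVertex hexGraph hexCenter Site)
open Literature.Probability.RandomPlanarGeometry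
open Literature.Probability.RandomPlanarGeometry.SAW

namespace Summit.CriticalPhenomena.SAWScalingLimit.Theorems.ObservableToSLER.TwoPiece

open Summit.CriticalPhenomena.SAWScalingLimit.Theorems.ObservableToSLE.FloorRatio
  (floorEdge_data dist_smul_mesh dist_mesh_le nonempty_hexMidEdgeSAW_of_preconnected
    archMass_le_archMass_add_farMass dist_hexCenter_hexMidpoint_le re_hexMidpoint_floorEdge
    im_hexMidpoint_floorEdge adj_floorEdge)

/-! ### Winding rigidity in modulus form -/

/-- **`‖F_{x_c,σ}(e)‖ = Z_Λ(a, e)` at a boundary mid-edge.**  For a simply connected hexagonal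
domain `Λ` and boundary mid-edges `a, e ∈ ∂Ω(Λ)`, all self-avoiding walks `a → e` of `Λ` have the
same winding (boundary winding rigidity, the route's landed support item), so the parafermionic
observable with source `a` at the critical fugacity has modulus equal to the critical two-point mass:
`‖F_{x_c,σ}(e)‖ = Σ_{γ ⊂ Λ : a → e} x_c^{ℓ(γ)}`. [cite: DuminilCopinSmirnov2012, §4 (the winding to a boundary mid-edge is determined)] -/
theorem norm_observable_eq_archMass {Λ : Finset HexVertex} (hΛ : hexDomainSimplyConnected Λ)
    {a e : Sym2 HexVertex} (ha : a ∈ hexDomainBoundary Λ) (he : e ∈ hexDomainBoundary Λ) (σ : ℝ) :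
    ‖hexParafermionicObservable Λ a hexCriticalFugacity σ e‖ =
      ∑ γ : HexMidEdgeSAW Λ a e, hexCriticalFugacity ^ γ.length := by
  have h0 : 0 ≤ hexCriticalFugacity := hexCriticalFugacity_pos_lt_one.1.le
  rcases isEmpty_or_nonempty (HexMidEdgeSAW Λ a e) with hE | ⟨⟨γ₀⟩⟩
  · rw [hexParafermionicObservable_def, Fintype.sum_empty, Fintype.sum_empty, norm_zero]
  · have key : hexParafermionicObservable Λ a hexCriticalFugacity σ e =
        Complex.exp (-Complex.I * σ * (γ₀.winding : ℝ)) *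
          ((∑ γ : HexMidEdgeSAW Λ a e, hexCriticalFugacity ^ γ.length : ℝ) : ℂ) := by
      rw [hexParafermionicObservable_def, Complex.ofReal_sum, Finset.mul_sum]
      refine Finset.sum_congr rfl fun γ _ => ?_
      rw [HexMidEdgeSAW.weight,
        Summit.CriticalPhenomena.SAWScalingLimit.Theorems.boundaryWindingRigidity_proof Λ hΛ a ha e
          he γ γ₀, Complex.ofReal_pow]
    rw [key, norm_mul, Complex.norm_exp]
    have hre : (-Complex.I * (σ : ℂ) * ((γ₀.winding : ℝ) : ℂ)).re = 0 := by
      simp [Complex.mul_re]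
    rw [hre, Real.exp_zero, one_mul, Complex.norm_real,
      Real.norm_of_nonneg (Finset.sum_nonneg fun _ _ => pow_nonneg h0 _)]

/-! ### Near/far splitting with mesh-scaled distances -/

/-- **Near/far splitting of the exact restriction deficit, mesh-scaled.**  At mesh `δ > 0`: if every
vertex of `Λ` whose scaled centre `δ c_v` is at distance `< R` from `δ·mid s` lies in `Λ'` (and `s`
is a mid-edge of `Ω(Λ')`), then `Z_Λ(s,t) ≤ Z_{Λ'}(s,t) + (far mass)`, the far mass being the
`x_c`-mass of the walks `s → t` of `Λ` having a vertex at scaled distance `≥ R` from `δ·mid s`.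
[cite: LawlerSchrammWerner2004SAW, §3.4 ("SAW satisfies restriction")] -/
theorem archMass_le_archMass_add_farMass_mesh {Λ Λ' : Finset HexVertex} {s t : Sym2 HexVertex}
    {R δ : ℝ} (hδ : 0 < δ) (hs : s ∈ hexDomainMidEdges Λ')
    (hnear : ∀ v ∈ Λ, dist ((δ : ℂ) * hexCenter v) ((δ : ℂ) * hexMidpoint s) < R → v ∈ Λ') :
    ∑ γ : HexMidEdgeSAW Λ s t, hexCriticalFugacity ^ γ.length ≤
      (∑ γ : HexMidEdgeSAW Λ' s t, hexCriticalFugacity ^ γ.length) +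
      ∑ γ : HexMidEdgeSAW Λ s t,
        (if ∃ v ∈ γ.verts, R ≤ dist ((δ : ℂ) * hexCenter v) ((δ : ℂ) * hexMidpoint s)
          then hexCriticalFugacity ^ γ.length else 0) := by
  have hiff : ∀ v : HexVertex, R ≤ dist ((δ : ℂ) * hexCenter v) ((δ : ℂ) * hexMidpoint s) ↔
      R / δ ≤ dist (hexCenter v) (hexMidpoint s) := fun v => by
    rw [dist_smul_mesh hδ.le, div_le_iff₀ hδ, mul_comm]
  have h := archMass_le_archMass_add_farMass (t := t) (R := R / δ) hs fun v hv hd =>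
    hnear v hv (by rwa [dist_smul_mesh hδ.le, mul_comm, ← lt_div_iff₀ hδ])
  refine h.trans (le_of_eq ?_)
  congr 1
  refine Finset.sum_congr rfl fun γ _ => ?_
  simp only [hiff]

/-! ### The local lattice floor data at the first marked point -/

/-- **The local lattice floor data (two-piece form).**  Let the families `Λ δ ⊇ Λ' δ` (connected)
be exact upper half-lattices with the common row threshold `m₀ δ` in the ball `B(p, ρ)`, let
`a δ ∈ ∂Ω(Λ δ)` with `δ·mid(a δ) → p`, and let `s ≠ p` be a floor point (`im s = im p`,
`|s - p| < ρ/4`); let `2r < ρ`.  Then there are lattice floor points `s_δ` with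
`δ·mid(s_δ) → s` such that eventually along `δ → 0⁺`: `s_δ` is a boundary mid-edge of `Λ δ` and of
`Λ' δ`, both walk spaces `a δ → s_δ` are nonempty, `mid(s_δ)` has the height of `mid(a δ)`, and
every vertex of `Λ δ` at scaled distance `< r` from `δ·mid(a δ)` lies in `Λ' δ`.  (Port of 10472's
`floorData` using only the LOCAL row clause at `p`.) [cite: DuminilCopinSmirnov2012, §3 (the bottom boundary α)] -/
theorem twoPieceFloorData {p : ℂ} {ρ : ℝ} (Λ Λ' : ℝ → Finset HexVertex) (m₀ : ℝ → ℤ)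
    (a : ℝ → Sym2 HexVertex) (hρ : 0 < ρ)
    (hev : ∀ᶠ δ : ℝ in 𝓝[>] 0,
      (hexGraph.induce (↑(Λ δ) : Set HexVertex)).Preconnected ∧
      (hexGraph.induce (↑(Λ' δ) : Set HexVertex)).Preconnected ∧
      a δ ∈ hexDomainBoundary (Λ δ) ∧
      (∀ v : HexVertex, (δ : ℂ) * hexCenter v ∈ ball p ρ →
        ((v ∈ Λ δ ↔ m₀ δ ≤ v.1 1) ∧ (v ∈ Λ' δ ↔ m₀ δ ≤ v.1 1))))
    (ha : Tendsto (fun δ : ℝ => (δ : ℂ) * hexMidpoint (a δ)) (𝓝[>] 0) (𝓝 p))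
    {s : ℂ} (hsa : s ≠ p) (hsim : s.im = p.im) (hsρ : dist s p < ρ / 4)
    {r : ℝ} (hrρ : 2 * r < ρ) :
    ∃ sE : ℝ → Sym2 HexVertex,
      Tendsto (fun δ : ℝ => (δ : ℂ) * hexMidpoint (sE δ)) (𝓝[>] 0) (𝓝 s) ∧
      ∀ᶠ δ : ℝ in 𝓝[>] 0,
        sE δ ∈ hexDomainBoundary (Λ δ) ∧ sE δ ∈ hexDomainBoundary (Λ' δ) ∧
        Nonempty (HexMidEdgeSAW (Λ δ) (a δ) (sE δ)) ∧
        Nonempty (HexMidEdgeSAW (Λ' δ) (a δ) (sE δ)) ∧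
        (hexMidpoint (sE δ)).im = (hexMidpoint (a δ)).im ∧
        (∀ v ∈ Λ δ, dist ((δ : ℂ) * hexCenter v) ((δ : ℂ) * hexMidpoint (a δ)) < r →
          v ∈ Λ' δ) := by
  set τ : ℝ := dist s p with hτdef
  have hτ : 0 < τ := dist_pos.2 hsa
  -- (A) floor form of `a δ`
  have hδρ : ∀ᶠ δ : ℝ in 𝓝[>] 0, δ < ρ := mem_nhdsWithin_of_mem_nhds (Iio_mem_nhds hρ)
  have hA : ∀ᶠ δ : ℝ in 𝓝[>] 0, ∃ x : Site 2, x 1 = m₀ δ ∧ a δ = s((x - Pi.single 1 1, 1), (x, 0)) ∧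
      (x, (0 : Fin 2)) ∈ Λ δ ∧ (x, (0 : Fin 2)) ∈ Λ' δ ∧
      (x - Pi.single 1 1, (1 : Fin 2)) ∉ Λ δ ∧ (x - Pi.single 1 1, (1 : Fin 2)) ∉ Λ' δ := by
    have h1 : ∀ᶠ δ : ℝ in 𝓝[>] 0, dist ((δ : ℂ) * hexMidpoint (a δ)) p < ρ / 2 :=
      Metric.tendsto_nhds.1 ha _ (half_pos hρ)
    filter_upwards [hev, h1, hδρ, self_mem_nhdsWithin] with δ hevδ h1 h2 hδ
    obtain ⟨-, -, haΛ, hrows⟩ := hevδ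
    exact floorEdge_data hδ h2 haΛ h1 hrows
  -- (B) the row height tends to the floor height
  have him_a : Tendsto (fun δ : ℝ => δ * ((m₀ δ : ℝ) * (Real.sqrt 3 / 2))) (𝓝[>] 0) (𝓝 p.im) := by
    refine ((Complex.continuous_im.tendsto _).comp ha).congr' ?_
    filter_upwards [hA] with δ ⟨x, hx1, hax, _⟩
    simp only [Function.comp_apply, Complex.mul_im, Complex.ofReal_re, Complex.ofReal_im, zero_mul,
      add_zero]
    rw [hax, im_hexMidpoint_floorEdge, hx1]
  -- (C) the lattice floor points `s_δ`
  set y : ℝ → Site 2 := fun δ => ![round (s.re / δ - (m₀ δ : ℝ) / 2 - 1 / 2), m₀ δ] with hy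
  have hy0 : ∀ δ, y δ 0 = round (s.re / δ - (m₀ δ : ℝ) / 2 - 1 / 2) := fun δ => rfl
  have hy1 : ∀ δ, y δ 1 = m₀ δ := fun δ => rfl
  set sE : ℝ → Sym2 HexVertex := fun δ => s((y δ - Pi.single 1 1, 1), (y δ, 0)) with hsE
  have hsE_re : ∀ δ : ℝ, 0 < δ → |δ * (hexMidpoint (sE δ)).re - s.re| ≤ δ / 2 := by
    intro δ hδ
    simp only [hsE]
    rw [re_hexMidpoint_floorEdge, hy0, hy1]
    set X : ℝ := s.re / δ - (m₀ δ : ℝ) / 2 - 1 / 2 with hX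
    have heq : δ * ((round X : ℤ) + (m₀ δ : ℝ) / 2 + 1 / 2) - s.re = δ * ((round X : ℤ) - X) := by
      rw [hX]; field_simp; ring
    rw [heq, abs_mul, abs_of_pos hδ, abs_sub_comm]
    have := abs_sub_round X
    nlinarith
  have hsE_lim : Tendsto (fun δ : ℝ => (δ : ℂ) * hexMidpoint (sE δ)) (𝓝[>] 0) (𝓝 s) := by
    have hre : Tendsto (fun δ : ℝ => δ * (hexMidpoint (sE δ)).re) (𝓝[>] 0) (𝓝 s.re) := by
      rw [Metric.tendsto_nhds]
      intro ε hε
      have hev1 : ∀ᶠ δ : ℝ in 𝓝[>] 0, δ < ε := mem_nhdsWithin_of_mem_nhds (Iio_mem_nhds hε)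
      filter_upwards [hev1, self_mem_nhdsWithin] with δ hδε hδ
      rw [Real.dist_eq]
      have := hsE_re δ hδ
      linarith
    have him : Tendsto (fun δ : ℝ => δ * (hexMidpoint (sE δ)).im) (𝓝[>] 0) (𝓝 s.im) := by
      rw [hsim]
      refine him_a.congr fun δ => ?_
      simp only [hsE]
      rw [im_hexMidpoint_floorEdge, hy1]
    have hfun : (fun δ : ℝ => (δ : ℂ) * hexMidpoint (sE δ)) = fun δ =>
        ((δ * (hexMidpoint (sE δ)).re : ℝ) : ℂ) + ((δ * (hexMidpoint (sE δ)).im : ℝ) : ℂ) * Complex.I := by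
      funext δ
      apply Complex.ext <;> simp
    rw [hfun, ← Complex.re_add_im s]
    exact ((Complex.continuous_ofReal.tendsto _).comp hre).add
      (((Complex.continuous_ofReal.tendsto _).comp him).mul tendsto_const_nhds)
  refine ⟨sE, hsE_lim, ?_⟩
  -- (D) eventual smallness
  have e1 : ∀ᶠ δ : ℝ in 𝓝[>] 0, dist ((δ : ℂ) * hexMidpoint (a δ)) p < τ / 4 :=
    Metric.tendsto_nhds.1 ha _ (by positivity)
  have e3 : ∀ᶠ δ : ℝ in 𝓝[>] 0, dist ((δ : ℂ) * hexMidpoint (sE δ)) s < τ / 4 :=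
    Metric.tendsto_nhds.1 hsE_lim _ (by positivity)
  filter_upwards [hev, hA, e1, e3, hδρ, self_mem_nhdsWithin] with δ hevδ
    ⟨x, hx1, hax, hx0Λ, hx0Λ', hxdΛ, hxdΛ'⟩ e1 e3 e5 hδ
  obtain ⟨hconn, hconn', -, hrows⟩ := hevδ
  have hδ0 : (0 : ℝ) < δ := hδ
  have hτρ : τ < ρ / 4 := hsρ
  -- the endpoints of `s_δ` lie in the rigid ball at `p`
  have hsEa : dist ((δ : ℂ) * hexMidpoint (sE δ)) p < τ / 4 + τ := by
    calc dist ((δ : ℂ) * hexMidpoint (sE δ)) p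
        ≤ dist ((δ : ℂ) * hexMidpoint (sE δ)) s + dist s p := dist_triangle _ _ _
      _ < τ / 4 + τ := by linarith
  have hsEedge : sE δ ∈ hexGraph.edgeSet := (SimpleGraph.mem_edgeSet hexGraph).2 (adj_floorEdge (y δ))
  have hsEball : ∀ w ∈ sE δ, (δ : ℂ) * hexCenter w ∈ ball p ρ := by
    intro w hw
    rw [mem_ball]
    have h := dist_mesh_le hδ0.le (dist_hexCenter_hexMidpoint_le hsEedge hw) hsEa.le
    calc dist ((δ : ℂ) * hexCenter w) p ≤ δ * (1 / 2) + (τ / 4 + τ) := h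
      _ < ρ := by linarith
  have hy0Λ : (y δ, (0 : Fin 2)) ∈ Λ δ :=
    (hrows _ (hsEball _ (Sym2.mem_mk_right _ _))).1.2 (le_of_eq (hy1 δ).symm)
  have hy0Λ' : (y δ, (0 : Fin 2)) ∈ Λ' δ :=
    (hrows _ (hsEball _ (Sym2.mem_mk_right _ _))).2.2 (le_of_eq (hy1 δ).symm)
  have hydΛ : (y δ - Pi.single 1 1, (1 : Fin 2)) ∉ Λ δ := fun h => by
    have := (hrows _ (hsEball _ (Sym2.mem_mk_left _ _))).1.1 h
    simp [hy1] at this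
  have hydΛ' : (y δ - Pi.single 1 1, (1 : Fin 2)) ∉ Λ' δ := fun h => by
    have := (hrows _ (hsEball _ (Sym2.mem_mk_left _ _))).2.1 h
    simp [hy1] at this
  have hsEbd : sE δ ∈ hexDomainBoundary (Λ δ) := ⟨hsEedge, _, _, rfl, hy0Λ, hydΛ⟩
  have hsEbd' : sE δ ∈ hexDomainBoundary (Λ' δ) := ⟨hsEedge, _, _, rfl, hy0Λ', hydΛ'⟩
  -- `a δ ≠ s_δ`: their scaled midpoints are `τ/2` apart
  have hd_as_ge : τ / 2 ≤ dist ((δ : ℂ) * hexMidpoint (a δ)) ((δ : ℂ) * hexMidpoint (sE δ)) := by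
    have h := dist_triangle4 p ((δ : ℂ) * hexMidpoint (a δ)) ((δ : ℂ) * hexMidpoint (sE δ)) s
    have h1 : dist p s = τ := by rw [hτdef, dist_comm]
    have h2 : dist p ((δ : ℂ) * hexMidpoint (a δ)) < τ / 4 := by rw [dist_comm]; exact e1
    linarith
  have hasE : a δ ≠ sE δ := by
    intro h; rw [h, dist_self] at hd_as_ge; linarith
  -- nonempty walk spaces
  have hne_as : Nonempty (HexMidEdgeSAW (Λ δ) (a δ) (sE δ)) := by
    rw [hax] at hasE ⊢
    exact nonempty_hexMidEdgeSAW_of_preconnected hconn (adj_floorEdge x) hxdΛ hx0Λ hydΛ hy0Λ hasE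
  have hne_as' : Nonempty (HexMidEdgeSAW (Λ' δ) (a δ) (sE δ)) := by
    rw [hax] at hasE ⊢
    exact nonempty_hexMidEdgeSAW_of_preconnected hconn' (adj_floorEdge x) hxdΛ' hx0Λ' hydΛ' hy0Λ' hasE
  -- equal heights
  have himeq : (hexMidpoint (sE δ)).im = (hexMidpoint (a δ)).im := by
    rw [hax]; simp only [hsE]; rw [im_hexMidpoint_floorEdge, im_hexMidpoint_floorEdge, hy1, hx1]
  -- the near region lies in the rigid ball, where `Λ δ` and `Λ' δ` agree
  have hnear : ∀ v ∈ Λ δ, dist ((δ : ℂ) * hexCenter v) ((δ : ℂ) * hexMidpoint (a δ)) < r →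
      v ∈ Λ' δ := by
    intro v hv hvd
    have hvball : (δ : ℂ) * hexCenter v ∈ ball p ρ := by
      rw [mem_ball]
      calc dist ((δ : ℂ) * hexCenter v) p
          ≤ dist ((δ : ℂ) * hexCenter v) ((δ : ℂ) * hexMidpoint (a δ)) +
              dist ((δ : ℂ) * hexMidpoint (a δ)) p := dist_triangle _ _ _
        _ < r + τ / 4 := by linarith
        _ < ρ := by linarith
    exact (hrows v hvball).2.2 ((hrows v hvball).1.1 hv)
  exact ⟨hsEbd, hsEbd', hne_as, hne_as', himeq, hnear⟩

/-! ### Registered form (sub-goal of `stub_twoPieceAdmRestrictionLimit`) -/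

/-- **Registered sub-goal `stub_twoPieceAdmRestrictionLimit_floorData`** (crux item
stmt-CriticalPhenomena-14005, line `bridge-gate-renewal` r7, stub 5a2
`stub_twoPieceAdmRestrictionLimit`): the local lattice floor data at the first marked point
(`twoPieceFloorData`). [cite: DuminilCopinSmirnov2012, §3 (the bottom boundary α)] -/
theorem stub_twoPieceAdmRestrictionLimit_floorData :
    ∀ (p : ℂ) (ρ : ℝ) (Λ Λ' : ℝ → Finset HexVertex) (m₀ : ℝ → ℤ) (a : ℝ → Sym2 HexVertex)
      (s : ℂ) (r : ℝ), 0 < ρ →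
      (∀ᶠ δ : ℝ in 𝓝[>] 0,
        (hexGraph.induce (↑(Λ δ) : Set HexVertex)).Preconnected ∧
        (hexGraph.induce (↑(Λ' δ) : Set HexVertex)).Preconnected ∧
        a δ ∈ hexDomainBoundary (Λ δ) ∧
        (∀ v : HexVertex, (δ : ℂ) * hexCenter v ∈ ball p ρ →
          ((v ∈ Λ δ ↔ m₀ δ ≤ v.1 1) ∧ (v ∈ Λ' δ ↔ m₀ δ ≤ v.1 1)))) →
      Tendsto (fun δ : ℝ => (δ : ℂ) * hexMidpoint (a δ)) (𝓝[>] 0) (𝓝 p) →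
      s ≠ p → s.im = p.im → dist s p < ρ / 4 → 2 * r < ρ →
      ∃ sE : ℝ → Sym2 HexVertex,
        Tendsto (fun δ : ℝ => (δ : ℂ) * hexMidpoint (sE δ)) (𝓝[>] 0) (𝓝 s) ∧
        ∀ᶠ δ : ℝ in 𝓝[>] 0,
          sE δ ∈ hexDomainBoundary (Λ δ) ∧ sE δ ∈ hexDomainBoundary (Λ' δ) ∧
          Nonempty (HexMidEdgeSAW (Λ δ) (a δ) (sE δ)) ∧
          Nonempty (HexMidEdgeSAW (Λ' δ) (a δ) (sE δ)) ∧
          (hexMidpoint (sE δ)).im = (hexMidpoint (a δ)).im ∧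
          (∀ v ∈ Λ δ, dist ((δ : ℂ) * hexCenter v) ((δ : ℂ) * hexMidpoint (a δ)) < r →
            v ∈ Λ' δ) :=
  fun _ _ Λ Λ' m₀ a _ _ hρ hev ha hsa hsim hsρ hrρ =>
    twoPieceFloorData Λ Λ' m₀ a hρ hev ha hsa hsim hsρ hrρ

end Summit.CriticalPhenomena.SAWScalingLimit.Theorems.ObservableToSLER.TwoPiece

end
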